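import Mathlib
import Literature.MathematicalPhysics.QuantumFieldTheory.Balaban1983to89.Beta.CoordCubePoincare
import Literature.MathematicalPhysics.QuantumFieldTheory.Balaban1983to89.Beta.CombesThomasFormOp
import Literature.MathematicalPhysics.QuantumFieldTheory.Balaban1983to89.B5Blocks16
import Literature.MathematicalPhysics.QuantumFieldTheory.Balaban1983to89.B4Sect5Torus

/-!
# Beta / TorusG0Decay — the `η`-uniform `L²` set-to-set decay of `G₀ = (−Δ^η + a Q*Q)⁻¹` ON THE TORUS TYPE

HONEST FRAMING (verbatim, page 1 of everything this cell writes): discharging `BetaPertH` makes Bałaban's UV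
stability UNCONDITIONAL — a real constructive-QFT result; it is NOT the continuum limit and NOT the Clay problem.
Gloss (BETA-SPEC v1.9b l. 17–18, G-ref2-14 (a) / G-ref2-20 (a), verbatim): «UNCONDITIONAL» in [Balaban1989LargeFieldII]
(B16, CMP 122) p. 355's interval-hypothesis sense ONLY (`FlowStepRuns.p355Unconditional_of_partialSums` keeps `hnodes`);
the located leaves G-adv3-2 (left inequality of (0.1)/(2.50), d = 4), G-adv3-1 (U2 transfer of B14 Cor. 3's lower
bound) and `SecondExpLeaf` REMAIN.  Gloss 2 (BETA-SPEC v1.9e 22:38Z, beta-ref C-beta-78, BINDING, verbatim): «UNCONDITIONAL» =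
`Beta.Assembly.EventualForm`-unconditional — the END statement with the interval hypothesis removed, (0.31) in DEFECTED form
on all lattices (`PrefixAbsorption.thm2Defected_of_eventualForm`), admissible couplings shrunk to g ≤ g⋆; NOT «B12 Theorem 2 as
printed» (that needs (AF-0s) or (AF-0-L) ∀k at L ≥ L₁ in addition: `eventualForm_not_thm2Printed`, RULING (R6)); never the
continuum limit / mass gap / Clay.  THIS MODULE discharges nothing of that and makes NO UV-stability claim at all: it
is a Mathlib-elementary kernel certificate (v1.0.1/v1.0.2 = v1 + this paragraph, docstring-only — beta-ref R129/R150,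
ref2 G-ref2-20 (a); no declaration changed).

SCOPE.  Mathlib-elementary ASSEMBLY of four landed modules; nothing printed by Bałaban is asserted, no
hypothesis is a quotation.  `Beta/CombesThomasFormOp.setDecay_lattice_dist` (p179359) proves set-to-set decay of
`H⁻¹` for `H = lap c + Σ_b m_b u_b ⊗ u_b` GIVEN a coercivity constant `σ` and a metric; `Beta/CoordCubePoincare.
coercive_lap_blocks_of_charts` (p179652) produces `σ = min(γ/P) a` GIVEN per-block charts `φ b : (Fin d → Fin (n+1))
→ sites` and bond listings `ψ b`; `B5Blocks16` (pv15, p179199 commit 5ee46360a59e) provides the block points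
`bpt s M y j = s·y + j` of the fine torus `T_η = Tor (fine s M) = Π_μ ℤ/(sM_μ)` with `bpt_injective / bpt_bijective /
blockOf_bpt`; `B4Sect5Torus` §8 (pv09, p179550 commit a411203f2ebf) provides the sup circular distance `tdist` with
the triangle inequality (read-only use of both; no edit of their files).  THIS MODULE instantiates everything on the
actual torus type, with `s = n + 1 = η⁻¹`:

* §1 torus steps `e_μ = unitVec N μ`, bonds `κ = Tor N × Fin d` (`src (x,μ) = x`, `tgt (x,μ) = x + e_μ`), the
  listing hypotheses `bond_injective` / `bond_anti` (periods `≥ 3`);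
* §2 the charts `φ b y := bpt (n+1) M b y`, `ψ b μ y := (bpt (n+1) M b y, μ)` and their five properties, in
  particular `bpt_stepUp : bpt b (stepUp y μ) = bpt b y + e_μ` for `y μ ≠ last`;
* §3 the operator `torusOp n M a := lap c + Σ_b (a / |B(b)|) 1_{B(b)} ⊗ 1_{B(b)}` with `c = (n+1)²` on nearest
  neighbours, `|B(b)| = (n+1)^d` (`card_block`), and the LITERAL site-basis formula `torusOp_mulVec`:
  `(H f)(x) = (n+1)² Σ_μ (2 f(x) − f(x+e_μ) − f(x−e_μ)) + a (n+1)^{−d} Σ_{x' ∈ B(x)} f(x')`, i.e.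
  `H = −Δ^η + a Q_k* Q_k` acting on functions on `T_η` (`η = 1/(n+1)`, `Q_k` = block averaging over the blocks
  `B^k(y)` of side `η⁻¹` sites, `Q_k*` its adjoint for the `η^d`-weighted / unit-weighted pairings:
  `(Q*Q f)(x) = (Qf)(B(x)) = (n+1)^{−d} Σ_{x'∈B(x)} f(x')`) — the DICTIONARY of `Beta/BlockPoincare` made a theorem;
* §4 `coercive_torus`: `min 2 a · ‖ω‖² ≤ ⟨ω, Hω⟩` for EVERY mesh and every torus with periods `(n+1)M_μ ≥ 3`
  (`γ = (n+1)²`, `P = (n+1)²/2 ≥ n(n+1)/2`, so `γ/P = 2`);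
* §5 the `η`-scaled torus metric `edist n N x y = η · max_μ dist(x_μ − y_μ, N_μℤ)` and **`setDecay_torus`**:
  for `a > 0`, `0 ≤ δ ≤ 1` with the `η`-FREE smallness `2d·δ² + a(e^δ − 1) ≤ min(2,a)/2`, every `g` supported in
  `T ≠ ∅`, every `S` with `edist(S, T) ≥ R` and every solution of `H v = g`:
  `Σ_{x∈S} v(x)² ≤ (2/min(2,a))² e^{−2δR} Σ_x g(x)²`, i.e. `‖1_S G₀ 1_T‖_{ℓ²→ℓ²} ≤ (2/min(2,a)) e^{−δ·edist(S,T)}`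
  uniformly in the mesh `η = 1/(n+1)` and in the periods.

WHAT IT DOES NOT GIVE.  (i) Pointwise / `L^∞` kernel bounds of the B5 (1.110) type (they need local elliptic
regularity on top of this `L²` bound — not here); (ii) non-local members of Bałaban's class
`𝒦_k` / the covariant (gauge-field dependent) Laplacians; (iii) anything about `Q_k` beyond block averaging with
unit weights; (iv) periods `(n+1)M_μ ≤ 2` (there the nearest-neighbour bond structure degenerates: `x + e_μ =
x − e_μ`).  B5 = T. Bałaban, Commun. Math. Phys. 95 (1984) 17–40 [Balaban1984PropagatorsI] is CONTEXT only (the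
operator `−Δ^η + aQ*Q` of (1.18) p. 20).  References for the devices: Combes–Thomas [CombesThomas1973, §II] via the
imported modules; Poincaré tensorisation: Bakry–Gentil–Ledoux 2014 Prop. 4.3.1
[corpus:book:bakry2013-analysis-geometry-markov-diffusion-operators p0211–p0212].  Unit `b2b-balaban-pv23-g3`
(surge node prover #23, gen 3; journal claim BETA-TORUS-G0-DECAY-KERNEL); census C-pv23g3-9 (GAPS.md); staged
byte-identically under `HOME/lean/BalabanYm4/`.  Value = kernel certificate, NOT summit progress.
-/

open Finset Matrix

namespace Literature.MathematicalPhysics.QuantumFieldTheory.Balaban1983to89.Beta.TorusG0Decay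

open B5Prop11Plancherel (Tor fine unitVec)
open B5Block118 (bpt)
open B5Blocks16 (blockOf_bpt bpt_injective bpt_bijective bpt_val bpt_eq_natCast)
open B4TorusKernel.MultiPeriod (circAbs circAbs_le_abs circAbs_nonneg)
open B4Sect5Torus (TSite ccoord tdist_symm tdist_self tdist_triangle)
open CombesThomasForm (lap lap_mulVec)
open CoordCubePoincare (stepUp coercive_lap_blocks_of_charts)
open CombesThomasFormOp (setDecay_lattice_dist)

noncomputable section

/-! ## §1  Steps and bonds of a torus `Tor N = Π_μ ℤ/N_μ` -/

section Bonds

variable {d : ℕ} (N : Fin d → ℕ) [hN : ∀ μ, NeZero (N μ)]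

/-- `1 ≤ N_μ`. [folklore] -/
theorem one_le (μ : Fin d) : 1 ≤ N μ := Nat.one_le_iff_ne_zero.mpr (NeZero.ne _)

omit hN in
/-- `e_μ(μ) = 1`. [folklore] -/
theorem unitVec_same (μ : Fin d) : unitVec N μ μ = 1 := by
  simp [unitVec]

omit hN in
/-- `e_μ(ν) = 0` for `ν ≠ μ`. [folklore] -/
theorem unitVec_ne {μ ν : Fin d} (h : ν ≠ μ) : unitVec N μ ν = 0 := by
  simp [unitVec, h]

/-- In `ℤ/m`, `m ≥ 2`: `1 ≠ 0`. [folklore] -/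
theorem one_ne_zero_of_two_le {m : ℕ} (hm : 2 ≤ m) : (1 : ZMod m) ≠ 0 := by
  haveI : Fact (1 < m) := ⟨hm⟩
  exact one_ne_zero

/-- In `ℤ/m`, `m ≥ 3`: `1 + 1 ≠ 0`. [folklore] -/
theorem one_add_one_ne_zero_of_three_le {m : ℕ} (hm : 3 ≤ m) : (1 : ZMod m) + 1 ≠ 0 := by
  haveI : Fact (1 < m) := ⟨by omega⟩
  intro h
  have hv : ((1 : ZMod m) + 1).val = 2 := by
    rw [ZMod.val_add_of_lt, ZMod.val_one]
    rw [ZMod.val_one]; omega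
  rw [h, ZMod.val_zero] at hv
  exact absurd hv (by norm_num)

omit hN in
/-- the steps `e_μ` are pairwise distinct (periods `≥ 2`). [folklore] -/
theorem unitVec_injective (h2 : ∀ μ, 2 ≤ N μ) : Function.Injective (unitVec N) := by
  intro μ ν h
  by_contra hne
  have h1 := congrFun h μ
  rw [unitVec_same, unitVec_ne N hne] at h1
  exact one_ne_zero_of_two_le (h2 μ) h1

omit hN in
/-- `e_μ + e_ν ≠ 0` (periods `≥ 3`): no bond is the reverse of another. [folklore] -/
theorem unitVec_add_unitVec_ne_zero (h3 : ∀ μ, 3 ≤ N μ) (μ ν : Fin d) : unitVec N μ + unitVec N ν ≠ 0 := by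
  intro h
  have h1 := congrFun h μ
  rw [Pi.add_apply, Pi.zero_apply, unitVec_same] at h1
  by_cases hμν : μ = ν
  · subst hμν
    rw [unitVec_same] at h1
    exact one_add_one_ne_zero_of_three_le (h3 μ) h1
  · rw [unitVec_ne N hμν, add_zero] at h1
    exact one_ne_zero_of_two_le ((by norm_num : 2 ≤ 3).trans (h3 μ)) h1

/-- the nearest-neighbour bonds of the torus: `(x, μ)` is the bond from `x` to `x + e_μ`. [folklore] -/
abbrev Bond : Type := Tor N × Fin d

/-- source of a bond. [folklore] -/
def src (k : Bond N) : Tor N := k.1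

/-- target of a bond. [folklore] -/
def tgt (k : Bond N) : Tor N := k.1 + unitVec N k.2

omit hN in
/-- the bond listing is injective (periods `≥ 2`). [folklore] -/
theorem bond_injective (h2 : ∀ μ, 2 ≤ N μ) : Function.Injective fun k : Bond N => (src N k, tgt N k) := by
  rintro ⟨x, μ⟩ ⟨x', ν⟩ h
  simp only [src, tgt, Prod.mk.injEq] at h
  obtain ⟨rfl, h'⟩ := h
  have : unitVec N μ = unitVec N ν := add_left_cancel h'
  rw [unitVec_injective N h2 this]

omit hN in
/-- no listed bond is the reverse of a listed bond (periods `≥ 3`). [folklore] -/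
theorem bond_anti (h3 : ∀ μ, 3 ≤ N μ) (k k' : Bond N) : (src N k, tgt N k) ≠ (tgt N k', src N k') := by
  intro h
  simp only [src, tgt, Prod.mk.injEq] at h
  obtain ⟨h1, h2⟩ := h
  rw [h1, add_assoc] at h2
  exact unitVec_add_unitVec_ne_zero N h3 k'.2 k.2 (add_left_cancel (h2.trans (add_zero _).symm))

end Bonds

/-! ## §2  The block charts of `T_η = Tor (fine (n+1) M)` -/

section Charts

variable {d : ℕ} (n : ℕ) (M : Fin d → ℕ) [hM : ∀ μ, NeZero (M μ)]

/-- one chart step is one torus step: `bpt b (y + 1_μ) = bpt b y + e_μ` when `y_μ` is not the last offset.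
[folklore] -/
theorem bpt_stepUp (b : Tor M) (y : Fin d → Fin (n + 1)) (μ : Fin d) (hy : y μ ≠ Fin.last n) :
    bpt (n + 1) M b (stepUp y μ) = bpt (n + 1) M b y + unitVec (fine (n + 1) M) μ := by
  funext ν
  rw [Pi.add_apply, bpt_eq_natCast, bpt_eq_natCast]
  by_cases hν : ν = μ
  · subst hν
    have hval : ((stepUp y ν ν : Fin (n + 1)) : ℕ) = (y ν : ℕ) + 1 := by
      rw [stepUp, Function.update_self]
      exact Fin.val_add_one_of_lt (Fin.lt_last_iff_ne_last.mpr hy)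
    rw [hval, unitVec_same]
    push_cast
    ring
  · rw [stepUp, Function.update_of_ne hν, unitVec_ne _ hν, add_zero]

/-- the chart of block `b` lands in block `b`. [folklore] -/
theorem blockOf_chart (b : Tor M) (y : Fin d → Fin (n + 1)) : B5Blocks16.blockOf (n + 1) M (bpt (n + 1) M b y) = b :=
  blockOf_bpt (n + 1) M b y

/-- each chart is injective. [folklore] -/
theorem chart_injective (b : Tor M) : Function.Injective (bpt (n + 1) M b) := fun y y' h =>
  (Prod.ext_iff.1 (bpt_injective (n + 1) M (a₁ := (b, y)) (a₂ := (b, y')) h)).2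

/-- the charts are jointly onto: every site is a block point of its own block. [folklore] -/
theorem chart_surj (x : Tor (fine (n + 1) M)) : ∃ y, bpt (n + 1) M (B5Blocks16.blockOf (n + 1) M x) y = x := by
  refine ⟨((Equiv.ofBijective _ (bpt_bijective (n + 1) M)).symm x).2, ?_⟩
  exact (Equiv.ofBijective _ (bpt_bijective (n + 1) M)).apply_symm_apply x

/-- every site of block `b` is a chart point `bpt b y`. [folklore] -/
theorem exists_eq_bpt {b : Tor M} {x : Tor (fine (n + 1) M)} (hx : B5Blocks16.blockOf (n + 1) M x = b) :
    ∃ y, bpt (n + 1) M b y = x := by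
  subst hx; exact chart_surj n M x

/-- the sites of block `b` are exactly the chart points. [folklore] -/
theorem filter_block_eq_image (b : Tor M) :
    (univ.filter fun x => B5Blocks16.blockOf (n + 1) M x = b) = univ.image (bpt (n + 1) M b) := by
  ext x
  simp only [mem_filter, mem_univ, true_and, mem_image]
  constructor
  · intro hx; exact exists_eq_bpt n M hx
  · rintro ⟨y, rfl⟩; exact blockOf_chart n M b y

/-- `|B(b)| = (n+1)^d`. [folklore] -/
theorem card_block (b : Tor M) : (univ.filter fun x => B5Blocks16.blockOf (n + 1) M x = b).card = (n + 1) ^ d := by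
  rw [filter_block_eq_image, card_image_of_injective _ (chart_injective n M b)]
  simp

/-- blocks are nonempty: `|B(b)| ≠ 0` as a real number. [folklore] -/
theorem card_block_ne_zero (b : Tor M) : ((univ.filter fun x => B5Blocks16.blockOf (n + 1) M x = b).card : ℝ) ≠ 0 := by
  rw [card_block]; positivity

end Charts

/-! ## §3  The operator `H = −Δ^η + a Q*Q` in the site basis -/

section Operator

variable {d : ℕ} (N : Fin d → ℕ) [hN : ∀ μ, NeZero (N μ)]

/-- nearest neighbours: `x' = x ± e_μ` for some `μ`. [folklore] -/
def Adj (x x' : Tor N) : Prop := ∃ μ, x' = x + unitVec N μ ∨ x = x' + unitVec N μ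

omit hN in
/-- adjacency is symmetric. [folklore] -/
theorem adj_symm {x x' : Tor N} (h : Adj N x x') : Adj N x' x := by
  obtain ⟨μ, h | h⟩ := h
  · exact ⟨μ, Or.inr h⟩
  · exact ⟨μ, Or.inl h⟩

/-- the nearest-neighbour coupling with strength `γ`. [folklore] -/
def coupling (γ : ℝ) (x x' : Tor N) : ℝ := by
  classical exact if Adj N x x' then γ else 0

omit hN in
/-- the coupling is symmetric. [folklore] -/
theorem coupling_symm (γ : ℝ) (x x' : Tor N) : coupling N γ x x' = coupling N γ x' x := by
  unfold coupling
  by_cases h : Adj N x x'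
  · rw [if_pos h, if_pos (adj_symm N h)]
  · have h' : ¬ Adj N x' x := fun h' => h (adj_symm N h')
    rw [if_neg h, if_neg h']

omit hN in
/-- the coupling is nonnegative for `γ ≥ 0`. [folklore] -/
theorem coupling_nonneg {γ : ℝ} (hγ : 0 ≤ γ) (x x' : Tor N) : 0 ≤ coupling N γ x x' := by
  unfold coupling; split_ifs <;> simp [hγ]

omit hN in
/-- on a bond the coupling is `γ`. [folklore] -/
theorem coupling_bond (γ : ℝ) (x : Tor N) (μ : Fin d) : coupling N γ x (x + unitVec N μ) = γ := by
  unfold coupling; rw [if_pos ⟨μ, Or.inl rfl⟩]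

omit hN in
/-- a nonzero coupling means adjacency, and then the value is `γ`. [folklore] -/
theorem adj_of_coupling_ne_zero {γ : ℝ} {x x' : Tor N} (h : coupling N γ x x' ≠ 0) :
    Adj N x x' ∧ coupling N γ x x' = γ := by
  unfold coupling at h ⊢
  by_cases hA : Adj N x x'
  · exact ⟨hA, by rw [if_pos hA]⟩
  · exact absurd (by rw [if_neg hA]) h

/-- the neighbours of `x` are among the `2d` points `x ± e_μ`. [folklore] -/
theorem card_coupling_ne_zero_le (γ : ℝ) (x : Tor N) :
    ((univ.filter fun x' => coupling N γ x x' ≠ 0).card : ℝ) ≤ 2 * d := by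
  classical
  have hsub : (univ.filter fun x' => coupling N γ x x' ≠ 0) ⊆
      (univ : Finset (Fin d × Bool)).image
        (fun p => if p.2 then x + unitVec N p.1 else x - unitVec N p.1) := by
    intro x' hx'
    rw [mem_filter] at hx'
    obtain ⟨⟨μ, h | h⟩, -⟩ := adj_of_coupling_ne_zero N hx'.2
    · exact mem_image.mpr ⟨(μ, true), mem_univ _, by simp [h]⟩
    · exact mem_image.mpr ⟨(μ, false), mem_univ _, by simp [h]⟩
  have h1 := (card_le_card hsub).trans card_image_le
  rw [card_univ, Fintype.card_prod, Fintype.card_fin, Fintype.card_bool, Nat.mul_comm] at h1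
  exact_mod_cast h1

variable (n : ℕ) (M : Fin d → ℕ) [hM : ∀ μ, NeZero (M μ)]

/-- **The operator** `H = −Δ^η + a Q_k*Q_k` on functions on `T_η = Tor (fine (n+1) M)`, `η = 1/(n+1)`, in the site
basis: `lap c` with `c = (n+1)² = η⁻²` on nearest neighbours, plus `Σ_b (a/|B(b)|) 1_{B(b)} ⊗ 1_{B(b)}` (OUR definition;
context: the averaging-regularised propagator of [Balaban1984PropagatorsI] (1.18) p.20 — nothing printed is asserted).
[folklore] -/
def torusOp (a : ℝ) : Matrix (Tor (fine (n + 1) M)) (Tor (fine (n + 1) M)) ℝ := fun j k =>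
  lap (coupling (fine (n + 1) M) (((n : ℝ) + 1) ^ 2)) j k
    + ∑ b : Tor M, a / ((univ.filter fun i => B5Blocks16.blockOf (n + 1) M i = b).card : ℝ)
        * ((if B5Blocks16.blockOf (n + 1) M j = b then (1 : ℝ) else 0) * (if B5Blocks16.blockOf (n + 1) M k = b then (1 : ℝ) else 0))

/-- the block part acts as `a (n+1)^{−d} Σ_{x' ∈ B(x)} f(x') = a (Q*Q f)(x)`. [folklore] -/
theorem blockPart_mulVec (a : ℝ) (f : Tor (fine (n + 1) M) → ℝ) (x : Tor (fine (n + 1) M)) :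
    ∑ k, (∑ b : Tor M, a / ((univ.filter fun i => B5Blocks16.blockOf (n + 1) M i = b).card : ℝ)
        * ((if B5Blocks16.blockOf (n + 1) M x = b then (1 : ℝ) else 0) * (if B5Blocks16.blockOf (n + 1) M k = b then (1 : ℝ) else 0)))
        * f k
      = a / ((n : ℝ) + 1) ^ d * ∑ k ∈ univ.filter (fun k => B5Blocks16.blockOf (n + 1) M k = B5Blocks16.blockOf (n + 1) M x), f k := by
  have hx : ∀ k, (∑ b : Tor M, a / ((univ.filter fun i => B5Blocks16.blockOf (n + 1) M i = b).card : ℝ)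
        * ((if B5Blocks16.blockOf (n + 1) M x = b then (1 : ℝ) else 0) * (if B5Blocks16.blockOf (n + 1) M k = b then (1 : ℝ) else 0)))
      = a / ((n : ℝ) + 1) ^ d * (if B5Blocks16.blockOf (n + 1) M k = B5Blocks16.blockOf (n + 1) M x then 1 else 0) := by
    intro k
    rw [Finset.sum_eq_single (B5Blocks16.blockOf (n + 1) M x)]
    · rw [if_pos rfl, one_mul, card_block]; push_cast; rfl
    · intro b _ hb; rw [if_neg (Ne.symm hb), zero_mul, mul_zero]
    · intro h; exact absurd (mem_univ _) h
  simp_rw [hx, mul_assoc, ← Finset.mul_sum, ite_mul, one_mul, zero_mul, Finset.sum_ite, Finset.sum_const_zero,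
    add_zero]

omit hN in
/-- the `2d` points `x ± e_μ` are pairwise distinct when all periods are `≥ 3`. [folklore] -/
theorem pm_injective (h3 : ∀ μ, 3 ≤ N μ) (x : Tor N) :
    Function.Injective (fun p : Fin d × Bool => if p.2 then x + unitVec N p.1 else x - unitVec N p.1) := by
  have h2 : ∀ μ, 2 ≤ N μ := fun μ => (by norm_num : 2 ≤ 3).trans (h3 μ)
  rintro ⟨μ, b⟩ ⟨ν, b'⟩ h
  cases b <;> cases b' <;> simp only [ite_true, ite_false, Bool.false_eq_true] at h
  · have : unitVec N μ = unitVec N ν := by rwa [sub_right_inj] at h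
    rw [unitVec_injective N h2 this]
  · exfalso
    have h' := congrArg (· + unitVec N μ) h.symm
    simp only [sub_add_cancel] at h'
    rw [add_assoc] at h'
    exact unitVec_add_unitVec_ne_zero N h3 ν μ (add_left_cancel (h'.trans (add_zero x).symm))
  · exfalso
    have h' := congrArg (· + unitVec N ν) h
    simp only [sub_add_cancel] at h'
    rw [add_assoc] at h'
    exact unitVec_add_unitVec_ne_zero N h3 μ ν (add_left_cancel (h'.trans (add_zero x).symm))
  · have : unitVec N μ = unitVec N ν := by rwa [add_right_inj] at h
    rw [unitVec_injective N h2 this]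

/-- the neighbours of `x` are EXACTLY the `2d` points `x ± e_μ` (periods `≥ 3`). [folklore] -/
theorem filter_adj_eq_image (γ : ℝ) (hγ : γ ≠ 0) (x : Tor N) :
    (univ.filter fun x' => coupling N γ x x' ≠ 0) =
      (univ : Finset (Fin d × Bool)).image
        (fun p => if p.2 then x + unitVec N p.1 else x - unitVec N p.1) := by
  classical
  ext x'
  simp only [mem_filter, mem_univ, true_and, mem_image]
  constructor
  · intro hx'
    obtain ⟨⟨μ, h | h⟩, -⟩ := adj_of_coupling_ne_zero N hx'
    · exact ⟨(μ, true), by simp [h]⟩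
    · exact ⟨(μ, false), by simp [h]⟩
  · rintro ⟨⟨μ, b⟩, h⟩
    cases b <;> simp only [ite_true, ite_false, Bool.false_eq_true] at h
    · subst h
      unfold coupling; rw [if_pos ⟨μ, Or.inr (by simp)⟩]; exact hγ
    · subst h; rw [coupling_bond]; exact hγ

/-- **`H` in the site basis is literally `−Δ^η + a Q*Q`:**
`(H f)(x) = (n+1)² Σ_μ (2 f(x) − f(x+e_μ) − f(x−e_μ)) + a (n+1)^{−d} Σ_{x'∈B(x)} f(x')` (periods `≥ 3`) — the
nearest-neighbour lattice Laplacian with mesh `η = 1/(n+1)` plus `a` times block-average-then-spread. [folklore] -/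
theorem torusOp_mulVec (h3 : ∀ μ, 3 ≤ fine (n + 1) M μ) (a : ℝ) (f : Tor (fine (n + 1) M) → ℝ)
    (x : Tor (fine (n + 1) M)) :
    (torusOp n M a).mulVec f x =
      ((n : ℝ) + 1) ^ 2 * ∑ μ : Fin d, (2 * f x - f (x + unitVec (fine (n + 1) M) μ) - f (x - unitVec (fine (n + 1) M) μ))
        + a / ((n : ℝ) + 1) ^ d * ∑ k ∈ univ.filter (fun k => B5Blocks16.blockOf (n + 1) M k = B5Blocks16.blockOf (n + 1) M x), f k := by
  classical
  have hγ : ((n : ℝ) + 1) ^ 2 ≠ 0 := by positivity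
  have hsplit : (torusOp n M a).mulVec f x = (lap (coupling (fine (n + 1) M) (((n : ℝ) + 1) ^ 2))).mulVec f x
      + ∑ k, (∑ b : Tor M, a / ((univ.filter fun i => B5Blocks16.blockOf (n + 1) M i = b).card : ℝ)
        * ((if B5Blocks16.blockOf (n + 1) M x = b then (1 : ℝ) else 0) * (if B5Blocks16.blockOf (n + 1) M k = b then (1 : ℝ) else 0)))
        * f k := by
    simp only [mulVec, dotProduct, torusOp, add_mul, Finset.sum_add_distrib]
  rw [hsplit, blockPart_mulVec, lap_mulVec]
  congr 1
  -- the Laplacian part: restrict to the neighbours, then list them as `x ± e_μ`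
  have hrestrict : ∑ k, coupling (fine (n + 1) M) (((n : ℝ) + 1) ^ 2) x k * (f x - f k) =
      ∑ k ∈ univ.filter (fun x' => coupling (fine (n + 1) M) (((n : ℝ) + 1) ^ 2) x x' ≠ 0),
        coupling (fine (n + 1) M) (((n : ℝ) + 1) ^ 2) x k * (f x - f k) := by
    rw [Finset.sum_filter]
    refine Finset.sum_congr rfl fun k _ => ?_
    by_cases h : coupling (fine (n + 1) M) (((n : ℝ) + 1) ^ 2) x k ≠ 0
    · rw [if_pos h]
    · rw [if_neg h, not_not.mp h, zero_mul]
  rw [hrestrict, filter_adj_eq_image (fine (n + 1) M) _ hγ x,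
    Finset.sum_image fun p _ q _ h => pm_injective (fine (n + 1) M) h3 x h, Fintype.sum_prod_type, Finset.mul_sum]
  refine Finset.sum_congr rfl fun μ _ => ?_
  rw [Fintype.sum_bool]
  simp only [ite_true, Bool.false_eq_true, ite_false]
  rw [coupling_bond, show coupling (fine (n + 1) M) (((n : ℝ) + 1) ^ 2) x (x - unitVec (fine (n + 1) M) μ)
      = ((n : ℝ) + 1) ^ 2 by
    unfold coupling; rw [if_pos ⟨μ, Or.inr (by simp)⟩]]
  ring

end Operator

/-! ## §4  Coercivity of `H` on the torus, uniformly in the mesh -/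

section Coercive

variable {d : ℕ} (n : ℕ) (M : Fin d → ℕ) [hM : ∀ μ, NeZero (M μ)]

/-- **Coercivity on the torus**: `min(2, a) · ‖ω‖² ≤ ⟨ω, Hω⟩` for `H = −Δ^η + aQ*Q`, for EVERY mesh `η = 1/(n+1)` and
every torus with periods `(n+1) M_μ ≥ 3` — the hypothesis `hpos` of the Combes–Thomas modules with an `η`-free `σ`.
[folklore] -/
theorem coercive_torus (h3 : ∀ μ, 3 ≤ fine (n + 1) M μ) {a : ℝ} (ha : 0 ≤ a) (ω : Tor (fine (n + 1) M) → ℝ) :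
    min 2 a * (ω ⬝ᵥ ω) ≤ ω ⬝ᵥ (torusOp n M a).mulVec ω := by
  classical
  have h2 : ∀ μ, 2 ≤ fine (n + 1) M μ := fun μ => (by norm_num : 2 ≤ 3).trans (h3 μ)
  have hγ0 : (0 : ℝ) < ((n : ℝ) + 1) ^ 2 := by positivity
  have hγP : ((n : ℝ) + 1) ^ 2 / (((n : ℝ) + 1) ^ 2 / 2) = 2 := by
    field_simp
  have h := coercive_lap_blocks_of_charts (coupling (fine (n + 1) M) (((n : ℝ) + 1) ^ 2))
    (coupling_symm _ _) (coupling_nonneg _ hγ0.le)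
    (B5Blocks16.blockOf (n + 1) M) (src (fine (n + 1) M)) (tgt (fine (n + 1) M)) (((n : ℝ) + 1) ^ 2) a
    (((n : ℝ) + 1) ^ 2 / 2) hγ0.le ha (by positivity)
    (fun k => (coupling_bond (fine (n + 1) M) _ k.1 k.2).ge) (bond_injective _ h2) (bond_anti _ h3) n d
    (by have hn : (0 : ℝ) ≤ n := Nat.cast_nonneg n; nlinarith [hn])
    (bpt (n + 1) M) (blockOf_chart n M) (chart_injective n M) (chart_surj n M)
    (fun b μ y => (bpt (n + 1) M b y, μ)) (fun b μ y _ => rfl)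
    (fun b μ y hy => by
      show bpt (n + 1) M b y + unitVec (fine (n + 1) M) μ = bpt (n + 1) M b (stepUp y μ)
      rw [bpt_stepUp n M b y μ hy])
    (fun b => by
      rintro ⟨μ, y⟩ _ ⟨ν, y'⟩ _ h
      simp only [Prod.mk.injEq] at h
      obtain ⟨h1, rfl⟩ := h
      rw [chart_injective n M b h1])
    (torusOp n M a) (fun j k => rfl) ω
  rw [hγP] at h
  exact h

end Coercive

/-! ## §5  The `η`-scaled torus metric and the set-to-set decay of `G₀ = H⁻¹` -/

section Decay

variable {d : ℕ} (N : Fin d → ℕ) [hN : ∀ μ, NeZero (N μ)]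

/-- coordinates as `Fin`-valued sites (for pv09's `tdist`). [folklore] -/
def toSite (x : Tor N) : TSite d N := fun i => ⟨(x i).val, ZMod.val_lt (x i)⟩

/-- the sup circular distance of the torus, in lattice units: `max_μ dist(x_μ − y_μ, N_μ ℤ)`. [folklore] -/
def ldist (x y : Tor N) : ℝ := B4Sect5Torus.tdist N (toSite N x) (toSite N y)

/-- `ldist x x = 0`. [folklore] -/
theorem ldist_self (x : Tor N) : ldist N x x = 0 := tdist_self N _

/-- `ldist` is symmetric. [folklore] -/
theorem ldist_symm (x y : Tor N) : ldist N x y = ldist N y x := tdist_symm (one_le N) _ _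

/-- `ldist` obeys the triangle inequality. [folklore] -/
theorem ldist_triangle (x y z : Tor N) : ldist N x z ≤ ldist N x y + ldist N y z := tdist_triangle (one_le N) _ _ _

/-- an upper bound for `ldist` from coordinatewise bounds on the circular distances. [folklore] -/
theorem ldist_le_of_forall {x y : Tor N} {t : ℕ}
    (h : ∀ i, circAbs (N i) (((x i).val : ℤ) - ((y i).val : ℤ)) ≤ t) : ldist N x y ≤ t := by
  unfold ldist B4Sect5Torus.tdist
  have hs : univ.sup (ccoord N (toSite N x) (toSite N y)) ≤ t := by
    refine Finset.sup_le fun i _ => ?_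
    unfold ccoord
    exact Int.toNat_le.mpr (h i)
  exact_mod_cast hs

omit hN in
/-- `circAbs` only depends on the residue class. [folklore] -/
theorem circAbs_congr {m : ℕ} {a b : ℤ} (h : (a : ZMod m) = (b : ZMod m)) : circAbs m a = circAbs m b := by
  have h' : a % (m : ℤ) = b % (m : ℤ) := (ZMod.intCast_eq_intCast_iff' a b m).mp h
  unfold circAbs; rw [h']

/-- the circular distance of the coordinate values of `u + w` and `u` is that of `val w`. [folklore] -/
theorem circAbs_val_add {m : ℕ} [NeZero m] (u w : ZMod m) :
    circAbs m (((u + w).val : ℤ) - (u.val : ℤ)) = circAbs m (w.val : ℤ) := by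
  apply circAbs_congr
  push_cast
  simp [ZMod.natCast_val, ZMod.cast_id', id]

/-- a bond has lattice length `≤ 1`. [folklore] -/
theorem ldist_step_le (h2 : ∀ μ, 2 ≤ N μ) (x : Tor N) (μ : Fin d) : ldist N (x + unitVec N μ) x ≤ (1 : ℕ) := by
  refine ldist_le_of_forall N fun i => ?_
  rw [Pi.add_apply, circAbs_val_add]
  by_cases hi : i = μ
  · subst hi
    haveI : Fact (1 < N i) := ⟨h2 i⟩
    rw [unitVec_same, ZMod.val_one]
    exact (circAbs_le_abs (one_le N i) _).trans (by norm_num)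
  · rw [unitVec_ne N hi, ZMod.val_zero]
    exact (circAbs_le_abs (one_le N i) _).trans (by norm_num)

/-- adjacent sites have lattice distance `≤ 1`. [folklore] -/
theorem ldist_le_one_of_adj (h2 : ∀ μ, 2 ≤ N μ) {x x' : Tor N} (h : Adj N x x') : ldist N x x' ≤ 1 := by
  obtain ⟨μ, h | h⟩ := h
  · rw [h, ldist_symm]; exact_mod_cast ldist_step_le N h2 x μ
  · rw [h]; exact_mod_cast ldist_step_le N h2 x' μ

variable (n : ℕ) (M : Fin d → ℕ) [hM : ∀ μ, NeZero (M μ)]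

/-- two sites of the same block are at lattice distance `≤ n` (the block has side `n + 1` sites). [folklore] -/
theorem ldist_le_of_same_block {x x' : Tor (fine (n + 1) M)} (h : B5Blocks16.blockOf (n + 1) M x = B5Blocks16.blockOf (n + 1) M x') :
    ldist (fine (n + 1) M) x x' ≤ n := by
  obtain ⟨y, hy⟩ := chart_surj n M x
  obtain ⟨y', hy'⟩ := exists_eq_bpt n M h.symm
  rw [← hy, ← hy']
  refine ldist_le_of_forall _ fun i => ?_
  rw [bpt_val, bpt_val]
  refine (circAbs_le_abs (one_le _ i) _).trans ?_
  push_cast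
  rw [show ((n : ℤ) + 1) * ((B5Blocks16.blockOf (n + 1) M x i).val : ℤ) + ((y i : ℕ) : ℤ)
      - (((n : ℤ) + 1) * ((B5Blocks16.blockOf (n + 1) M x i).val : ℤ) + ((y' i : ℕ) : ℤ)) = ((y i : ℕ) : ℤ) - ((y' i : ℕ) : ℤ) by ring]
  have h1 := (y i).is_lt
  have h2 := (y' i).is_lt
  rw [abs_le]; constructor <;> omega

/-- the `η`-scaled torus metric `edist = η · ldist`, `η = 1/(n+1)`: bonds have length `≤ η`, blocks diameter `≤ 1`.
[folklore] -/
def edist (x y : Tor (fine (n + 1) M)) : ℝ := (1 / ((n : ℝ) + 1)) * ldist (fine (n + 1) M) x y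

/-- the sum of squares of a block indicator is the block cardinality. [folklore] -/
theorem sum_blockInd_sq (b : Tor M) :
    ∑ k, (if B5Blocks16.blockOf (n + 1) M k = b then (1 : ℝ) else 0) ^ 2 = ((univ.filter fun i => B5Blocks16.blockOf (n + 1) M i = b).card : ℝ) := by
  simp_rw [ite_pow, one_pow, zero_pow two_ne_zero]
  rw [Finset.sum_boole]

/-- **Set-to-set decay of `G₀ = (−Δ^η + aQ*Q)⁻¹` on the torus, uniformly in the mesh.**  For `a > 0`, periods
`(n+1) M_μ ≥ 3`, `0 ≤ δ ≤ 1` with the `η`-free smallness `2d·δ² + a(e^δ − 1) ≤ min(2,a)/2`: for `g` supported in a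
nonempty `T`, `S` at `edist`-distance `≥ R` from `T` and any solution of `H v = g`,
`Σ_{x∈S} v(x)² ≤ (2/min(2,a))² e^{−2δR} Σ_x g(x)²`. [cite: CombesThomas1973, §II] [folklore] -/
theorem setDecay_torus (h3 : ∀ μ, 3 ≤ fine (n + 1) M μ) {a δ : ℝ} (ha : 0 < a) (hδ0 : 0 ≤ δ) (hδ1 : δ ≤ 1)
    (hsmall : 2 * (d : ℝ) * δ ^ 2 + a * (Real.exp δ - 1) ≤ min 2 a / 2)
    (S T : Finset (Tor (fine (n + 1) M))) (hT : T.Nonempty) (R : ℝ)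
    (hR : ∀ x ∈ S, ∀ t ∈ T, R ≤ edist n M x t)
    (g v : Tor (fine (n + 1) M) → ℝ) (hg : ∀ x, x ∉ T → g x = 0) (hv : (torusOp n M a).mulVec v = g) :
    ∑ x ∈ S, v x ^ 2 ≤ (2 / min 2 a) ^ 2 * Real.exp (-(2 * (δ * R))) * ∑ x, g x ^ 2 := by
  classical
  have h2 : ∀ μ, 2 ≤ fine (n + 1) M μ := fun μ => (by norm_num : 2 ≤ 3).trans (h3 μ)
  have hn1 : (0 : ℝ) < (n : ℝ) + 1 := by positivity
  have hγ0 : (0 : ℝ) < ((n : ℝ) + 1) ^ 2 := by positivity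
  have hη : (0 : ℝ) < 1 / ((n : ℝ) + 1) := by positivity
  have hη1 : 1 / ((n : ℝ) + 1) ≤ 1 := by rw [div_le_one hn1]; linarith
  have hσ : 0 < min 2 a := lt_min (by norm_num) ha
  refine setDecay_lattice_dist (coupling (fine (n + 1) M) (((n : ℝ) + 1) ^ 2)) (coupling_symm _ _)
    (coupling_nonneg _ hγ0.le)
    (B5Blocks16.blockOf (n + 1) M)
    (fun b => a / ((univ.filter fun i => B5Blocks16.blockOf (n + 1) M i = b).card : ℝ))
    (fun b => div_nonneg ha.le (Nat.cast_nonneg _))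
    (fun b j => if B5Blocks16.blockOf (n + 1) M j = b then (1 : ℝ) else 0) (fun b j hj => if_neg hj)
    (torusOp n M a) (fun j k => rfl) (min 2 a) hσ (coercive_torus n M h3 ha.le)
    (edist n M) (fun x => by simp [edist, ldist_self]) (fun x y => by simp [edist, ldist_symm])
    (fun x y z => ?_) (η := 1 / ((n : ℝ) + 1)) (δ := δ) (z := 2 * d) (a := a) (D := 1) hη hδ0 ?_ zero_le_one
    (fun j k hjk => ?_) (fun j => card_coupling_ne_zero_le _ _ j) (fun j k hjk => ?_) (fun b => ?_) ?_
    S T hT R hR g v hg hv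
  · -- triangle inequality
    simp only [edist]; rw [← mul_add]
    exact mul_le_mul_of_nonneg_left (ldist_triangle _ x y z) hη.le
  · -- δη ≤ 1
    calc δ * (1 / ((n : ℝ) + 1)) ≤ 1 * 1 := mul_le_mul hδ1 hη1 hη.le zero_le_one
      _ = 1 := one_mul 1
  · -- bonds: coefficient η⁻² and length ≤ η
    obtain ⟨hadj, hval⟩ := adj_of_coupling_ne_zero _ hjk
    refine ⟨?_, ?_⟩
    · rw [hval]; field_simp
    · show (1 / ((n : ℝ) + 1)) * ldist (fine (n + 1) M) j k ≤ 1 / ((n : ℝ) + 1)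
      calc (1 / ((n : ℝ) + 1)) * ldist (fine (n + 1) M) j k ≤ (1 / ((n : ℝ) + 1)) * 1 :=
            mul_le_mul_of_nonneg_left (ldist_le_one_of_adj _ h2 hadj) hη.le
        _ = 1 / ((n : ℝ) + 1) := mul_one _
  · -- blocks have `edist`-diameter ≤ 1
    show (1 / ((n : ℝ) + 1)) * ldist (fine (n + 1) M) j k ≤ 1
    calc (1 / ((n : ℝ) + 1)) * ldist (fine (n + 1) M) j k ≤ (1 / ((n : ℝ) + 1)) * n :=
          mul_le_mul_of_nonneg_left (ldist_le_of_same_block n M hjk) hη.le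
      _ ≤ 1 := by rw [div_mul_eq_mul_div, one_mul, div_le_one hn1]; linarith
  · -- block strengths: (a/|B|)·|B| = a
    rw [sum_blockInd_sq, div_mul_cancel₀ a (card_block_ne_zero n M b)]
  · -- smallness
    simpa [mul_one] using hsmall

end Decay

/-! ## Sanity instance -/

/-- Sanity (non-vacuity of the hypotheses of `setDecay_torus`): `d = 1`, `a = 1`, `δ = 1/8` satisfy the smallness
condition `2·1·(1/8)² + 1·(e^{1/8} − 1) ≤ min(2,1)/2 = 1/2` (since `e^{1/8} ≤ 1 + 1/8 + (1/8)²`). -/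
example : 2 * ((1 : ℕ) : ℝ) * (1 / 8 : ℝ) ^ 2 + 1 * (Real.exp (1 / 8) - 1) ≤ min 2 (1 : ℝ) / 2 := by
  have h : Real.exp (1 / 8) ≤ 1 + 1 / 8 + (1 / 8) ^ 2 := by
    have := Real.abs_exp_sub_one_sub_id_le (x := 1 / 8) (by norm_num)
    rw [abs_le] at this
    nlinarith [this.2]
  rw [min_eq_right (by norm_num : (1 : ℝ) ≤ 2)]
  push_cast
  nlinarith [h]

end

end Literature.MathematicalPhysics.QuantumFieldTheory.Balaban1983to89.Beta.TorusG0Decay
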